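import Summits.BirchSwinnertonDyer.BirchSwinnertonDyer.Theorems.ResidualThetaTransportAtTwoThetaLayerLambdaCongruenceAtTwoWSideStabilization
import Mathlib.Analysis.Normed.Unbundled.SpectralNorm
import HarnessLib

/-!
# Crux `ThetaLayerLambdaCongruenceAtTwo` (stmt-BirchSwinnertonDyer-20688): UNCONDITIONAL stabilisation of the PARTNER-side sup norms
# (discreteness of `‖ι(K_g)‖` via the spectral norm) and the eventual `λ`-growth law `λ_{n+2}(g) = λ_n(g) + 2ⁿ`

Width seat bsd-wall-rtt-p3-w3 (`--supports stmt-BirchSwinnertonDyer-20688`; closes nothing). THEOREMS ONLY.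

* §1 `eventually_const_of_monotone_of_zpow_base`: a non-decreasing bounded real sequence with values in `{0} ∪ c^ℤ` (`c > 1`) is
  eventually constant.
* §2 **DISCRETENESS OF `‖ι(K_g)‖`**: for a newform `g` (so `K_g` is a number field, `IsNewform0.finiteDimensional_coeffField_holds`)
  and any ring embedding `ι : K_g → ℚ̄₂`, every `‖ι y‖` is `0` or an integral power of `c_g = 2^{1/d!}`, `d = [K_g : ℚ]`
  (`norm_emb_coeffField_eq_zpow`): the norm on `ℚ̄₂` is the spectral norm, `‖x‖ = ‖a₀(x)‖^{1/m}` with `a₀` the constant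
  coefficient of the minimal polynomial of `x` over `ℚ₂` (Mathlib `spectralNorm.spectralNorm_eq_norm_coeff_zero_rpow`), `m ≤ d`.
* §3 the partner's depleted element is `K_g`-RATIONAL (`exists_map_eq_gSide`), uniformly BOUNDED at any plus period (Manin:
  `CohomologicalPeriod.exists_norm_plusSymbolK_eq_max`) and MONOTONE along parity classes (`…TowerGrowth`); hence
  (`gSide_supNorm_eventually_const`) its sup norms are EVENTUALLY CONSTANT and (`gSide_eventual_growth`) for every parity class
  with a non-zero element there is `n₁` with `Θ^{S₀}_{n₁}(g;Ω) ≠ 0` and `3λ(Θ_{n₁+2k}(g;Ω)) + 2^{n₁} = 3λ(Θ_{n₁}(g;Ω)) + 2^{n₁}4^k`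
  for all `k` — the partner-side analytic layer law at `p = 2`, UNCONDITIONALLY (no `μ = 0`, no Pollack pair, any plus period).

With `…WSideStabilization` this makes `λ_n(W) − λ_n(g)` EVENTUALLY CONSTANT along even `n` unconditionally (companion glue
`…EventualCrux`: Kan⁺ ⟸ `λ`-equality at infinitely many even layers). Nothing about any curve or form is asserted; BSD is not
proved by any of this.

References: [PollackWeston2011MT] Thm. 4.1, §4; [BoschGuntzerRemmert1984] §3.2 (spectral norm; via Mathlib); [Shimura1971] Thm. 3.48.
-/

noncomputable section

-- justification: the `Summit.BirchSwinnertonDyer.BirchSwinnertonDyer.…` path repeats a component (route-file convention)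
set_option linter.dupNamespace false

open scoped Classical

open Polynomial

open Literature.NumberTheory.IwasawaTheory Literature.NumberTheory.EllipticCurves
  Literature.NumberTheory.EllipticCurves.ModularForms

namespace Summit.BirchSwinnertonDyer.BirchSwinnertonDyer.Theorems.ThetaLayerLambdaCongruenceAtTwo

/-! ## §1. Eventual constancy for values in `{0} ∪ c^ℤ` -/

/-- A non-decreasing sequence of reals, bounded above, all of whose values are `0` or integral powers of a fixed `c > 1`, is
eventually constant (its range is finite). [folklore] -/
theorem eventually_const_of_monotone_of_zpow_base {c : ℝ} (hc : 1 < c) {u : ℕ → ℝ} (hmono : Monotone u) {B : ℝ}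
    (hB : ∀ k, u k ≤ B) (hval : ∀ k, u k = 0 ∨ ∃ m : ℤ, u k = c ^ m) : ∃ K : ℕ, ∀ k, K ≤ k → u k = u K := by
  classical
  have hc0 : 0 < c := zero_lt_one.trans hc
  have hfin : (Set.range u).Finite := by
    by_cases hz : ∀ k, u k = 0
    · exact (Set.finite_singleton (0 : ℝ)).subset (by rintro _ ⟨k, rfl⟩; simp [hz k])
    push Not at hz
    obtain ⟨k₀, hk₀⟩ := hz
    obtain ⟨m₀, hm₀⟩ := (hval k₀).resolve_left hk₀
    obtain ⟨N, hN⟩ := pow_unbounded_of_one_lt B hc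
    refine ((Set.finite_Iio k₀).image u).union
      (((Set.finite_Icc m₀ (N : ℤ)).image fun m : ℤ ↦ c ^ m)) |>.subset ?_
    rintro _ ⟨k, rfl⟩
    by_cases hk : k < k₀
    · exact Or.inl ⟨k, hk, rfl⟩
    · right
      have hge : u k₀ ≤ u k := hmono (not_lt.mp hk)
      have hpos : 0 < u k := by rw [hm₀] at hge; exact lt_of_lt_of_le (zpow_pos hc0 _) hge
      obtain ⟨m, hm⟩ := (hval k).resolve_left hpos.ne'
      refine ⟨m, ⟨?_, ?_⟩, hm.symm⟩
      · rw [hm₀, hm] at hge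
        exact (zpow_le_zpow_iff_right₀ hc).mp hge
      · have h1 : c ^ m < c ^ (N : ℤ) := by
          rw [← hm, zpow_natCast]; exact (hB k).trans_lt hN
        exact ((zpow_lt_zpow_iff_right₀ hc).mp h1).le
  obtain ⟨x, hx, hmax⟩ := hfin.toFinset.exists_max_image id ⟨u 0, by simp⟩
  obtain ⟨K, rfl⟩ : ∃ K, u K = x := by simpa using hx
  refine ⟨K, fun k hk ↦ le_antisymm ?_ (hmono hk)⟩
  exact hmax (u k) (by simp)

/-! ## §2. Discreteness of the norms of `ι(K_g)` in `ℚ̄₂` -/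

/-- **Norms of algebraic elements of bounded degree over `ℚ₂` are discrete**: if `x ∈ ℚ̄₂`, `x ≠ 0`, has minimal polynomial over
`ℚ₂` of degree `≤ d`, then `‖x‖ = (2^{1/d!})^k` for some `k ∈ ℤ` — the norm of `ℚ̄₂` is the spectral norm,
`‖x‖ = ‖a₀‖^{1/m}` (`spectralNorm.spectralNorm_eq_norm_coeff_zero_rpow`), `‖a₀‖ ∈ 2^ℤ`, `m ∣ d!`. [cite: BoschGuntzerRemmert1984, §3.2.1 Prop. 4 (spectral norm; via Mathlib)] -/
theorem norm_padicAlgCl_eq_zpow_of_natDegree_minpoly_le (x : PadicAlgCl 2) (hx : x ≠ 0) {d : ℕ}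
    (hd : (minpoly ℚ_[2] x).natDegree ≤ d) :
    ∃ k : ℤ, ‖x‖ = ((2 : ℝ) ^ ((1 : ℝ) / (Nat.factorial d))) ^ k := by
  have hint : IsIntegral ℚ_[2] x := (Algebra.IsAlgebraic.isAlgebraic (R := ℚ_[2]) x).isIntegral
  set m := (minpoly ℚ_[2] x).natDegree with hm
  have hmpos : 0 < m := minpoly.natDegree_pos hint
  have ha0 : (minpoly ℚ_[2] x).coeff 0 ≠ 0 := minpoly.coeff_zero_ne_zero hint hx
  have hnorm : ‖x‖ = ‖(minpoly ℚ_[2] x).coeff 0‖ ^ (1 / m : ℝ) := by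
    rw [← PadicAlgCl.spectralNorm_eq, spectralNorm.spectralNorm_eq_norm_coeff_zero_rpow]
  rw [Padic.norm_eq_zpow_neg_valuation ha0] at hnorm
  simp only [Nat.cast_ofNat] at hnorm
  obtain ⟨q, hq⟩ := Nat.dvd_factorial hmpos hd
  refine ⟨-((minpoly ℚ_[2] x).coeff 0).valuation * q, ?_⟩
  rw [hnorm, ← Real.rpow_intCast, ← Real.rpow_intCast, ← Real.rpow_mul (by norm_num : (0:ℝ) ≤ 2),
    ← Real.rpow_mul (by norm_num : (0:ℝ) ≤ 2)]
  congr 1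
  have hm0 : (m : ℝ) ≠ 0 := by exact_mod_cast hmpos.ne'
  have hq0 : (q : ℝ) ≠ 0 := by
    rintro hq0'
    have : q = 0 := by exact_mod_cast hq0'
    rw [this, mul_zero] at hq
    exact (Nat.factorial_pos d).ne' hq
  have hfac : ((Nat.factorial d : ℕ) : ℝ) = (m : ℝ) * (q : ℝ) := by exact_mod_cast hq
  push_cast
  rw [hfac]
  field_simp

section GSide

variable {M : ℕ} [NeZero M] {g : CuspForm (CongruenceSubgroup.Gamma0 M) 2}
  (ι : coeffField g →+* PadicAlgCl 2) (Ω : ℂ)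
  (S₀ : Finset (IsDedekindDomain.HeightOneSpectrum (NumberField.RingOfIntegers ℚ)))

/-- **The `ℚ₂`-degree of `ι y`, `y ∈ K_g`, is at most `[K_g : ℚ]`** (the minimal polynomial over `ℚ₂` divides the image of the one
over `ℚ`; `K_g` is a number field for a newform, `IsNewform0.finiteDimensional_coeffField_holds`). [cite: Shimura1971, Thm. 3.48] -/
theorem natDegree_minpoly_emb_le (hg : IsNewform0 g) (y : coeffField g) :
    (minpoly ℚ_[2] (ι y)).natDegree ≤ Module.finrank ℚ (coeffField g) := by
  haveI : FiniteDimensional ℚ (coeffField g) := IsNewform0.finiteDimensional_coeffField_holds hg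
  have hy : IsIntegral ℚ y := .of_finite ℚ y
  have hP : (minpoly ℚ y).map (algebraMap ℚ ℚ_[2]) ≠ 0 :=
    (Polynomial.map_ne_zero_iff (algebraMap ℚ ℚ_[2]).injective).mpr (minpoly.ne_zero hy)
  have hroot : aeval (ι y) ((minpoly ℚ y).map (algebraMap ℚ ℚ_[2])) = 0 := by
    rw [aeval_map_algebraMap]
    have h := Polynomial.aeval_algHom_apply (ι.toRatAlgHom) y (minpoly ℚ y)
    rw [minpoly.aeval, map_zero] at h
    exact h
  calc (minpoly ℚ_[2] (ι y)).natDegree ≤ ((minpoly ℚ y).map (algebraMap ℚ ℚ_[2])).natDegree :=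
        Polynomial.natDegree_le_of_dvd (minpoly.dvd ℚ_[2] (ι y) hroot) hP
    _ = (minpoly ℚ y).natDegree := Polynomial.natDegree_map _
    _ ≤ Module.finrank ℚ (coeffField g) := minpoly.natDegree_le y

/-- **DISCRETENESS of `‖ι(K_g)‖`**: for a newform `g` and any `ι : K_g → ℚ̄₂`, `‖ι y‖` is `0` or an integral power of
`c_g = 2^{1/[K_g:ℚ]!}`. [cite: BoschGuntzerRemmert1984, §3.2.1 (spectral norm; via Mathlib)] -/
theorem norm_emb_coeffField_eq_zpow (hg : IsNewform0 g) (y : coeffField g) :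
    ‖ι y‖ = 0 ∨ ∃ k : ℤ, ‖ι y‖ = ((2 : ℝ) ^ ((1 : ℝ) / (Nat.factorial (Module.finrank ℚ (coeffField g))))) ^ k := by
  by_cases h0 : ι y = 0
  · left; rw [h0, norm_zero]
  · exact Or.inr (norm_padicAlgCl_eq_zpow_of_natDegree_minpoly_le (ι y) h0 (natDegree_minpoly_emb_le ι hg y))

/-! ## §3. The partner's depleted element: `K_g`-rational, bounded, monotone ⇒ eventually constant norms -/

/-- `(X+1)^{2^k} − 1` over a field is monic (private helper). [folklore] -/
private theorem monic_X_add_one_pow_two_pow_sub_one_field'' (K : Type*) [Field K] (k : ℕ) :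
    ((X + 1 : K[X]) ^ 2 ^ k - 1).Monic := by
  have e : (X + 1 : K[X]) = X + C 1 := by rw [C_1]
  have hlt : (1 : K[X]).natDegree < ((X + 1 : K[X]) ^ 2 ^ k).natDegree := by
    rw [e, natDegree_pow, natDegree_X_add_C, mul_one, natDegree_one]; exact pow_pos two_pos _
  exact Monic.sub_of_left (by rw [e]; exact (monic_X_add_C 1).pow _) (degree_lt_degree hlt)

omit [NeZero M] in
/-- **The partner's depleted layer element is `K_g`-rational**: it is the image under `ι` of a polynomial over `K_g`.
[cite: PollackWeston2011MT, §2.1 (2.1)] -/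
theorem exists_map_eq_gSide (n : ℕ) : ∃ R : (coeffField g)[X], R.map ι = (((Literature.NumberTheory.EllipticCurves.mazurTateElementK g Ω 2 n).map ι * ∏ v ∈ S₀, (1 - Polynomial.C (Literature.NumberTheory.EllipticCurves.embCoeff g ι (Rat.HeightOneSpectrum.natGenerator v)) * Polynomial.X + (if Rat.HeightOneSpectrum.natGenerator v ∣ M then 0 else Polynomial.C (Rat.HeightOneSpectrum.natGenerator v : PadicAlgCl 2)) * Polynomial.X ^ 2).comp (Polynomial.C ((Rat.HeightOneSpectrum.natGenerator v : PadicAlgCl 2)⁻¹) * (Polynomial.X + 1) ^ (PadicInt.toZModPow n (-(Literature.NumberTheory.EllipticCurves.GreenbergVatsal2000.frobeniusExponent 2 (Rat.HeightOneSpectrum.natGenerator v : ℤ_[2])))).val)) %ₘ ((Polynomial.X + 1) ^ 2 ^ n - 1)) := by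
  refine ⟨(mazurTateElementK g Ω 2 n * ∏ v ∈ S₀,
    (1 - C (⟨cuspCoeff g (Rat.HeightOneSpectrum.natGenerator v), coeff_mem_coeffField g _⟩ : coeffField g) * X +
      (if Rat.HeightOneSpectrum.natGenerator v ∣ M then 0
        else C ((Rat.HeightOneSpectrum.natGenerator v : coeffField g))) * X ^ 2).comp
    (C ((Rat.HeightOneSpectrum.natGenerator v : coeffField g)⁻¹) * (X + 1) ^ (PadicInt.toZModPow n
      (-(Literature.NumberTheory.EllipticCurves.GreenbergVatsal2000.frobeniusExponent 2
        (Rat.HeightOneSpectrum.natGenerator v : ℤ_[2])))).val)) %ₘ ((X + 1) ^ 2 ^ n - 1), ?_⟩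
  rw [Polynomial.map_modByMonic _ (monic_X_add_one_pow_two_pow_sub_one_field'' (coeffField g) n)]
  simp only [Polynomial.map_mul, Polynomial.map_prod, Polynomial.map_comp, Polynomial.map_pow, Polynomial.map_add,
    Polynomial.map_sub, Polynomial.map_X, Polynomial.map_one, Polynomial.map_C, map_inv₀, map_natCast,
    Polynomial.map_natCast, apply_ite (Polynomial.map ι), Polynomial.map_zero, ← embCoeff_def]

/-- **Uniform bound for the partner's element at ANY plus period**: `‖Θ^{S₀}_n(g;Ω)‖_sup ≤ ‖2‖·B` for every `n`, with `B`
the maximum of the `‖ι[r]⁺_{g,Ω}‖` (Manin's trick, `CohomologicalPeriod.exists_norm_plusSymbolK_eq_max`). [cite: CremonaAlgorithms1997, §2.3 (Manin's trick; shape)] -/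
theorem exists_supNorm_gSide_le (hg : IsNewform0 g) (hΩ : IsPlusPeriod g Ω)
    (hS2 : ∀ v ∈ S₀, ((2 : ℕ) : NumberField.RingOfIntegers ℚ) ∉ v.asIdeal) :
    ∃ B : ℝ, ∀ n : ℕ, ((((Literature.NumberTheory.EllipticCurves.mazurTateElementK g Ω 2 n).map ι * ∏ v ∈ S₀, (1 - Polynomial.C (Literature.NumberTheory.EllipticCurves.embCoeff g ι (Rat.HeightOneSpectrum.natGenerator v)) * Polynomial.X + (if Rat.HeightOneSpectrum.natGenerator v ∣ M then 0 else Polynomial.C (Rat.HeightOneSpectrum.natGenerator v : PadicAlgCl 2)) * Polynomial.X ^ 2).comp (Polynomial.C ((Rat.HeightOneSpectrum.natGenerator v : PadicAlgCl 2)⁻¹) * (Polynomial.X + 1) ^ (PadicInt.toZModPow n (-(Literature.NumberTheory.EllipticCurves.GreenbergVatsal2000.frobeniusExponent 2 (Rat.HeightOneSpectrum.natGenerator v : ℤ_[2])))).val)) %ₘ ((Polynomial.X + 1) ^ 2 ^ n - 1))).supNorm ≤ B := by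
  obtain ⟨B, -, hBpos, hBle, -⟩ := CohomologicalPeriod.exists_norm_plusSymbolK_eq_max hg ι hΩ
  refine ⟨‖(2 : PadicAlgCl 2)‖ * B, fun n ↦ ?_⟩
  haveI : NeZero (2 ^ n) := ⟨pow_ne_zero _ two_ne_zero⟩
  refine (supNorm_modByMonic_le (monic_layerModulus (p := 2) n) (supNorm_layerModulus_le_one (p := 2) n) _).trans ?_
  rw [supNorm_mul', supNorm_map_mazurTateElementK_two_eq]
  have hE := supNorm_prod_le_one S₀ _ fun v hv ↦
    supNorm_partnerEulerFactor_le_one hg ι M (not_two_dvd_natGenerator (hS2 v hv))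
      (PadicInt.toZModPow n (-(Literature.NumberTheory.EllipticCurves.GreenbergVatsal2000.frobeniusExponent 2
        (Rat.HeightOneSpectrum.natGenerator v : ℤ_[2])))).val
  have hS : (∑ s : ZMod (2 ^ n), C (ι (plusSymbolK g Ω
      (((((cyclotomicGenerator 2 : ZMod (2 ^ (n + 2))) ^ s.val).val : ℕ) : ℚ) / (2 : ℚ) ^ (n + 2)))) *
        (X + 1) ^ s.val).supNorm ≤ B :=
    (supNorm_sum_C_mul_X_add_one_pow_le_iff _ hBpos.le).mpr fun t ↦ hBle _
  calc ‖(2 : PadicAlgCl 2)‖ * _ * _ ≤ ‖(2 : PadicAlgCl 2)‖ * B * 1 :=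
        mul_le_mul (mul_le_mul_of_nonneg_left hS (norm_nonneg _)) hE (supNorm_nonneg _)
          (mul_nonneg (norm_nonneg _) hBpos.le)
    _ = ‖(2 : PadicAlgCl 2)‖ * B := mul_one _

/-- **Partner-side monotonicity**: `‖Θ^{S₀}_n(g;Ω)‖_sup ≤ ‖Θ^{S₀}_{n+2}(g;Ω)‖_sup` (`2 ∤ M`, `a₂(g) = 0`, any plus period).
[cite: PollackWeston2011MT, §4 (shape)] -/
theorem gSide_supNorm_le_add_two (hg : IsNewform0 g) (h2M : ¬ 2 ∣ M) (ha2 : cuspCoeff g 2 = 0)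
    (hΩ : IsPlusPeriod g Ω) (n : ℕ) : ((((Literature.NumberTheory.EllipticCurves.mazurTateElementK g Ω 2 n).map ι * ∏ v ∈ S₀, (1 - Polynomial.C (Literature.NumberTheory.EllipticCurves.embCoeff g ι (Rat.HeightOneSpectrum.natGenerator v)) * Polynomial.X + (if Rat.HeightOneSpectrum.natGenerator v ∣ M then 0 else Polynomial.C (Rat.HeightOneSpectrum.natGenerator v : PadicAlgCl 2)) * Polynomial.X ^ 2).comp (Polynomial.C ((Rat.HeightOneSpectrum.natGenerator v : PadicAlgCl 2)⁻¹) * (Polynomial.X + 1) ^ (PadicInt.toZModPow n (-(Literature.NumberTheory.EllipticCurves.GreenbergVatsal2000.frobeniusExponent 2 (Rat.HeightOneSpectrum.natGenerator v : ℤ_[2])))).val)) %ₘ ((Polynomial.X + 1) ^ 2 ^ n - 1))).supNorm ≤ ((((Literature.NumberTheory.EllipticCurves.mazurTateElementK g Ω 2 (n + 2)).map ι * ∏ v ∈ S₀, (1 - Polynomial.C (Literature.NumberTheory.EllipticCurves.embCoeff g ι (Rat.HeightOneSpectrum.natGenerator v)) * Polynomial.X + (if Rat.HeightOneSpectrum.natGenerator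 v ∣ M then 0 else Polynomial.C (Rat.HeightOneSpectrum.natGenerator v : PadicAlgCl 2)) * Polynomial.X ^ 2).comp (Polynomial.C ((Rat.HeightOneSpectrum.natGenerator v : PadicAlgCl 2)⁻¹) * (Polynomial.X + 1) ^ (PadicInt.toZModPow (n + 2) (-(Literature.NumberTheory.EllipticCurves.GreenbergVatsal2000.frobeniusExponent 2 (Rat.HeightOneSpectrum.natGenerator v : ℤ_[2])))).val)) %ₘ ((Polynomial.X + 1) ^ 2 ^ (n + 2) - 1))).supNorm :=
  supNorm_layer_le_add_two_generic ι Ω S₀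
    (fun v ↦ 1 - C (embCoeff g ι (Rat.HeightOneSpectrum.natGenerator v)) * X +
      (if Rat.HeightOneSpectrum.natGenerator v ∣ M then 0 else C (Rat.HeightOneSpectrum.natGenerator v : PadicAlgCl 2)) *
        X ^ 2)
    (fun v ↦ ((Rat.HeightOneSpectrum.natGenerator v : PadicAlgCl 2)⁻¹))
    (fun v ↦ -(Literature.NumberTheory.EllipticCurves.GreenbergVatsal2000.frobeniusExponent 2
      (Rat.HeightOneSpectrum.natGenerator v : ℤ_[2])))
    hg h2M ha2 hΩ n

/-- **The partner-side sup norms are EVENTUALLY CONSTANT along each parity class (unconditionally, any plus period)**: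
`∃ K, ∀ k ≥ K, ‖Θ^{S₀}_{n₀+2k}(g;Ω)‖_sup = ‖Θ^{S₀}_{n₀+2K}(g;Ω)‖_sup` — monotone, bounded, values in `{0} ∪ c_g^ℤ`.
[cite: PollackWeston2011MT, §4 (μ-stabilisation; shape)] -/
theorem gSide_supNorm_eventually_const (hg : IsNewform0 g) (h2M : ¬ 2 ∣ M) (ha2 : cuspCoeff g 2 = 0)
    (hΩ : IsPlusPeriod g Ω) (hS2 : ∀ v ∈ S₀, ((2 : ℕ) : NumberField.RingOfIntegers ℚ) ∉ v.asIdeal) (n₀ : ℕ) :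
    ∃ K : ℕ, ∀ k : ℕ, K ≤ k → ((((Literature.NumberTheory.EllipticCurves.mazurTateElementK g Ω 2 (n₀ + 2 * k)).map ι * ∏ v ∈ S₀, (1 - Polynomial.C (Literature.NumberTheory.EllipticCurves.embCoeff g ι (Rat.HeightOneSpectrum.natGenerator v)) * Polynomial.X + (if Rat.HeightOneSpectrum.natGenerator v ∣ M then 0 else Polynomial.C (Rat.HeightOneSpectrum.natGenerator v : PadicAlgCl 2)) * Polynomial.X ^ 2).comp (Polynomial.C ((Rat.HeightOneSpectrum.natGenerator v : PadicAlgCl 2)⁻¹) * (Polynomial.X + 1) ^ (PadicInt.toZModPow (n₀ + 2 * k) (-(Literature.NumberTheory.EllipticCurves.GreenbergVatsal2000.frobeniusExponent 2 (Rat.HeightOneSpectrum.natGenerator v : ℤ_[2])))).val)) %ₘ ((Polynomial.X + 1) ^ 2 ^ (n₀ + 2 * k) - 1))).supNorm = ((((Literature.NumberTheory.EllipticCurves.mazurTateElementK g Ω 2 (n₀ + 2 * K)).map ι * ∏ v ∈ S₀, (1 - Polynomial.C (Literature.NumberTheory.EllipticCurves.embCoeff g ι (Rat.HeightOneSpectrum.natGenerator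 v)) * Polynomial.X + (if Rat.HeightOneSpectrum.natGenerator v ∣ M then 0 else Polynomial.C (Rat.HeightOneSpectrum.natGenerator v : PadicAlgCl 2)) * Polynomial.X ^ 2).comp (Polynomial.C ((Rat.HeightOneSpectrum.natGenerator v : PadicAlgCl 2)⁻¹) * (Polynomial.X + 1) ^ (PadicInt.toZModPow (n₀ + 2 * K) (-(Literature.NumberTheory.EllipticCurves.GreenbergVatsal2000.frobeniusExponent 2 (Rat.HeightOneSpectrum.natGenerator v : ℤ_[2])))).val)) %ₘ ((Polynomial.X + 1) ^ 2 ^ (n₀ + 2 * K) - 1))).supNorm := by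
  set u : ℕ → ℝ := fun k ↦ ((((Literature.NumberTheory.EllipticCurves.mazurTateElementK g Ω 2 (n₀ + 2 * k)).map ι * ∏ v ∈ S₀, (1 - Polynomial.C (Literature.NumberTheory.EllipticCurves.embCoeff g ι (Rat.HeightOneSpectrum.natGenerator v)) * Polynomial.X + (if Rat.HeightOneSpectrum.natGenerator v ∣ M then 0 else Polynomial.C (Rat.HeightOneSpectrum.natGenerator v : PadicAlgCl 2)) * Polynomial.X ^ 2).comp (Polynomial.C ((Rat.HeightOneSpectrum.natGenerator v : PadicAlgCl 2)⁻¹) * (Polynomial.X + 1) ^ (PadicInt.toZModPow (n₀ + 2 * k) (-(Literature.NumberTheory.EllipticCurves.GreenbergVatsal2000.frobeniusExponent 2 (Rat.HeightOneSpectrum.natGenerator v : ℤ_[2])))).val)) %ₘ ((Polynomial.X + 1) ^ 2 ^ (n₀ + 2 * k) - 1))).supNorm with hu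
  have hmono : Monotone u := by
    refine monotone_nat_of_le_succ fun k ↦ ?_
    simp only [hu]
    exact gSide_supNorm_le_add_two ι Ω S₀ hg h2M ha2 hΩ (n₀ + 2 * k)
  obtain ⟨B, hB⟩ := exists_supNorm_gSide_le ι Ω S₀ hg hΩ hS2
  have hc : (1 : ℝ) < (2 : ℝ) ^ ((1 : ℝ) / (Nat.factorial (Module.finrank ℚ (coeffField g)))) :=
    Real.one_lt_rpow (by norm_num) (by positivity)
  have hval : ∀ k, u k = 0 ∨ ∃ m : ℤ, u k = ((2 : ℝ) ^ ((1 : ℝ) / (Nat.factorial (Module.finrank ℚ (coeffField g))))) ^ m := by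
    intro k
    obtain ⟨R, hR⟩ := exists_map_eq_gSide ι Ω S₀ (n₀ + 2 * k)
    simp only [hu]
    rw [← hR]
    obtain ⟨i, hi⟩ := (R.map ι).exists_eq_supNorm
    rw [hi, coeff_map]
    exact norm_emb_coeffField_eq_zpow ι hg _
  exact eventually_const_of_monotone_of_zpow_base hc hmono (fun k ↦ hB _) hval

/-- **THE PARTNER-SIDE ANALYTIC LAYER LAW AT `p = 2`, UNCONDITIONALLY** (no `μ = 0`, no Pollack/Sprung pair, ANY plus period
`Ω`): for a newform `g` on `Γ₀(M)`, `2 ∤ M`, `a₂(g) = 0`, every `S₀` off `2` and every parity class `n₀ + 2ℕ` containing a non-zero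
depleted element, there is `n₁ = n₀ + 2j₀` with `Θ^{S₀}_{n₁}(g;Ω) ≠ 0` and
`3λ(Θ^{S₀}_{n₁+2k}(g;Ω)) + 2^{n₁} = 3λ(Θ^{S₀}_{n₁}(g;Ω)) + 2^{n₁}·4^k` for ALL `k`. [cite: PollackWeston2011MT, Thm. 4.1 (λ(θ_n) = q_n + λ; read at 2, partner side)] -/
theorem gSide_eventual_growth (hg : IsNewform0 g) (h2M : ¬ 2 ∣ M) (ha2 : cuspCoeff g 2 = 0)
    (hΩ : IsPlusPeriod g Ω) (hS2 : ∀ v ∈ S₀, ((2 : ℕ) : NumberField.RingOfIntegers ℚ) ∉ v.asIdeal) (n₀ : ℕ)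
    (hne : ∃ j : ℕ, (((Literature.NumberTheory.EllipticCurves.mazurTateElementK g Ω 2 (n₀ + 2 * j)).map ι * ∏ v ∈ S₀, (1 - Polynomial.C (Literature.NumberTheory.EllipticCurves.embCoeff g ι (Rat.HeightOneSpectrum.natGenerator v)) * Polynomial.X + (if Rat.HeightOneSpectrum.natGenerator v ∣ M then 0 else Polynomial.C (Rat.HeightOneSpectrum.natGenerator v : PadicAlgCl 2)) * Polynomial.X ^ 2).comp (Polynomial.C ((Rat.HeightOneSpectrum.natGenerator v : PadicAlgCl 2)⁻¹) * (Polynomial.X + 1) ^ (PadicInt.toZModPow (n₀ + 2 * j) (-(Literature.NumberTheory.EllipticCurves.GreenbergVatsal2000.frobeniusExponent 2 (Rat.HeightOneSpectrum.natGenerator v : ℤ_[2])))).val)) %ₘ ((Polynomial.X + 1) ^ 2 ^ (n₀ + 2 * j) - 1)) ≠ 0) :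
    ∃ j₀ : ℕ, (((Literature.NumberTheory.EllipticCurves.mazurTateElementK g Ω 2 (n₀ + 2 * j₀)).map ι * ∏ v ∈ S₀, (1 - Polynomial.C (Literature.NumberTheory.EllipticCurves.embCoeff g ι (Rat.HeightOneSpectrum.natGenerator v)) * Polynomial.X + (if Rat.HeightOneSpectrum.natGenerator v ∣ M then 0 else Polynomial.C (Rat.HeightOneSpectrum.natGenerator v : PadicAlgCl 2)) * Polynomial.X ^ 2).comp (Polynomial.C ((Rat.HeightOneSpectrum.natGenerator v : PadicAlgCl 2)⁻¹) * (Polynomial.X + 1) ^ (PadicInt.toZModPow (n₀ + 2 * j₀) (-(Literature.NumberTheory.EllipticCurves.GreenbergVatsal2000.frobeniusExponent 2 (Rat.HeightOneSpectrum.natGenerator v : ℤ_[2])))).val)) %ₘ ((Polynomial.X + 1) ^ 2 ^ (n₀ + 2 * j₀) - 1)) ≠ 0 ∧ ∀ k : ℕ,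
      3 * layerLambda (((Literature.NumberTheory.EllipticCurves.mazurTateElementK g Ω 2 (n₀ + 2 * j₀ + 2 * k)).map ι * ∏ v ∈ S₀, (1 - Polynomial.C (Literature.NumberTheory.EllipticCurves.embCoeff g ι (Rat.HeightOneSpectrum.natGenerator v)) * Polynomial.X + (if Rat.HeightOneSpectrum.natGenerator v ∣ M then 0 else Polynomial.C (Rat.HeightOneSpectrum.natGenerator v : PadicAlgCl 2)) * Polynomial.X ^ 2).comp (Polynomial.C ((Rat.HeightOneSpectrum.natGenerator v : PadicAlgCl 2)⁻¹) * (Polynomial.X + 1) ^ (PadicInt.toZModPow (n₀ + 2 * j₀ + 2 * k) (-(Literature.NumberTheory.EllipticCurves.GreenbergVatsal2000.frobeniusExponent 2 (Rat.HeightOneSpectrum.natGenerator v : ℤ_[2])))).val)) %ₘ ((Polynomial.X + 1) ^ 2 ^ (n₀ + 2 * j₀ + 2 * k) - 1)) + 2 ^ (n₀ + 2 * j₀) = 3 * layerLambda (((Literature.NumberTheory.EllipticCurves.mazurTateElementK g Ω 2 (n₀ + 2 * j₀)).map ι * ∏ v ∈ S₀, (1 - Polynomial.C (Literature.NumberTheory.EllipticCurves.embCoeff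 g ι (Rat.HeightOneSpectrum.natGenerator v)) * Polynomial.X + (if Rat.HeightOneSpectrum.natGenerator v ∣ M then 0 else Polynomial.C (Rat.HeightOneSpectrum.natGenerator v : PadicAlgCl 2)) * Polynomial.X ^ 2).comp (Polynomial.C ((Rat.HeightOneSpectrum.natGenerator v : PadicAlgCl 2)⁻¹) * (Polynomial.X + 1) ^ (PadicInt.toZModPow (n₀ + 2 * j₀) (-(Literature.NumberTheory.EllipticCurves.GreenbergVatsal2000.frobeniusExponent 2 (Rat.HeightOneSpectrum.natGenerator v : ℤ_[2])))).val)) %ₘ ((Polynomial.X + 1) ^ 2 ^ (n₀ + 2 * j₀) - 1)) + 2 ^ (n₀ + 2 * j₀) * 4 ^ k := by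
  obtain ⟨K, hK⟩ := gSide_supNorm_eventually_const ι Ω S₀ hg h2M ha2 hΩ hS2 n₀
  set u : ℕ → ℝ := fun k ↦ ((((Literature.NumberTheory.EllipticCurves.mazurTateElementK g Ω 2 (n₀ + 2 * k)).map ι * ∏ v ∈ S₀, (1 - Polynomial.C (Literature.NumberTheory.EllipticCurves.embCoeff g ι (Rat.HeightOneSpectrum.natGenerator v)) * Polynomial.X + (if Rat.HeightOneSpectrum.natGenerator v ∣ M then 0 else Polynomial.C (Rat.HeightOneSpectrum.natGenerator v : PadicAlgCl 2)) * Polynomial.X ^ 2).comp (Polynomial.C ((Rat.HeightOneSpectrum.natGenerator v : PadicAlgCl 2)⁻¹) * (Polynomial.X + 1) ^ (PadicInt.toZModPow (n₀ + 2 * k) (-(Literature.NumberTheory.EllipticCurves.GreenbergVatsal2000.frobeniusExponent 2 (Rat.HeightOneSpectrum.natGenerator v : ℤ_[2])))).val)) %ₘ ((Polynomial.X + 1) ^ 2 ^ (n₀ + 2 * k) - 1))).supNorm with hu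
  have hmono : Monotone u := by
    refine monotone_nat_of_le_succ fun k ↦ ?_
    simp only [hu]
    exact gSide_supNorm_le_add_two ι Ω S₀ hg h2M ha2 hΩ (n₀ + 2 * k)
  obtain ⟨j, hj⟩ := hne
  have hjpos : 0 < u j := lt_of_le_of_ne (supNorm_nonneg _) (Ne.symm ((supNorm_eq_zero_iff _).not.mpr hj))
  have hKpos : 0 < u K := by
    have h1 : u j ≤ u (max K j) := hmono (le_max_right _ _)
    have h2 : u (max K j) = u K := hK _ (le_max_left _ _)
    linarith
  have h0 : (((Literature.NumberTheory.EllipticCurves.mazurTateElementK g Ω 2 (n₀ + 2 * K)).map ι * ∏ v ∈ S₀, (1 - Polynomial.C (Literature.NumberTheory.EllipticCurves.embCoeff g ι (Rat.HeightOneSpectrum.natGenerator v)) * Polynomial.X + (if Rat.HeightOneSpectrum.natGenerator v ∣ M then 0 else Polynomial.C (Rat.HeightOneSpectrum.natGenerator v : PadicAlgCl 2)) * Polynomial.X ^ 2).comp (Polynomial.C ((Rat.HeightOneSpectrum.natGenerator v : PadicAlgCl 2)⁻¹) * (Polynomial.X + 1) ^ (PadicInt.toZModPow (n₀ + 2 *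 K) (-(Literature.NumberTheory.EllipticCurves.GreenbergVatsal2000.frobeniusExponent 2 (Rat.HeightOneSpectrum.natGenerator v : ℤ_[2])))).val)) %ₘ ((Polynomial.X + 1) ^ 2 ^ (n₀ + 2 * K) - 1)) ≠ 0 := fun hz ↦ by
    have : u K = 0 := by simp only [hu]; rw [hz, supNorm_zero]
    exact hKpos.ne' this
  have hst' : ∀ k : ℕ, ((((Literature.NumberTheory.EllipticCurves.mazurTateElementK g Ω 2 (n₀ + 2 * K + 2 * k + 2)).map ι * ∏ v ∈ S₀, (1 - Polynomial.C (Literature.NumberTheory.EllipticCurves.embCoeff g ι (Rat.HeightOneSpectrum.natGenerator v)) * Polynomial.X + (if Rat.HeightOneSpectrum.natGenerator v ∣ M then 0 else Polynomial.C (Rat.HeightOneSpectrum.natGenerator v : PadicAlgCl 2)) * Polynomial.X ^ 2).comp (Polynomial.C ((Rat.HeightOneSpectrum.natGenerator v : PadicAlgCl 2)⁻¹) * (Polynomial.X + 1) ^ (PadicInt.toZModPow (n₀ + 2 * K + 2 * k + 2) (-(Literature.NumberTheory.EllipticCurves.GreenbergVatsal2000.frobeniusExponent 2 (Rat.HeightOneSpectrum.natGenerator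 v : ℤ_[2])))).val)) %ₘ ((Polynomial.X + 1) ^ 2 ^ (n₀ + 2 * K + 2 * k + 2) - 1))).supNorm ≤ ((((Literature.NumberTheory.EllipticCurves.mazurTateElementK g Ω 2 (n₀ + 2 * K + 2 * k)).map ι * ∏ v ∈ S₀, (1 - Polynomial.C (Literature.NumberTheory.EllipticCurves.embCoeff g ι (Rat.HeightOneSpectrum.natGenerator v)) * Polynomial.X + (if Rat.HeightOneSpectrum.natGenerator v ∣ M then 0 else Polynomial.C (Rat.HeightOneSpectrum.natGenerator v : PadicAlgCl 2)) * Polynomial.X ^ 2).comp (Polynomial.C ((Rat.HeightOneSpectrum.natGenerator v : PadicAlgCl 2)⁻¹) * (Polynomial.X + 1) ^ (PadicInt.toZModPow (n₀ + 2 * K + 2 * k) (-(Literature.NumberTheory.EllipticCurves.GreenbergVatsal2000.frobeniusExponent 2 (Rat.HeightOneSpectrum.natGenerator v : ℤ_[2])))).val)) %ₘ ((Polynomial.X + 1) ^ 2 ^ (n₀ + 2 * K + 2 * k) - 1))).supNorm := by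
    intro k
    have h1 := hK (K + k + 1) (by omega)
    have h2 := hK (K + k) (by omega)
    have e1 : n₀ + 2 * K + 2 * k + 2 = n₀ + 2 * (K + k + 1) := by ring
    have e2 : n₀ + 2 * K + 2 * k = n₀ + 2 * (K + k) := by ring
    change (fun m : ℕ ↦ ((((Literature.NumberTheory.EllipticCurves.mazurTateElementK g Ω 2 m).map ι * ∏ v ∈ S₀, (1 - Polynomial.C (Literature.NumberTheory.EllipticCurves.embCoeff g ι (Rat.HeightOneSpectrum.natGenerator v)) * Polynomial.X + (if Rat.HeightOneSpectrum.natGenerator v ∣ M then 0 else Polynomial.C (Rat.HeightOneSpectrum.natGenerator v : PadicAlgCl 2)) * Polynomial.X ^ 2).comp (Polynomial.C ((Rat.HeightOneSpectrum.natGenerator v : PadicAlgCl 2)⁻¹) * (Polynomial.X + 1) ^ (PadicInt.toZModPow m (-(Literature.NumberTheory.EllipticCurves.GreenbergVatsal2000.frobeniusExponent 2 (Rat.HeightOneSpectrum.natGenerator v : ℤ_[2])))).val)) %ₘ ((Polynomial.X + 1) ^ 2 ^ m - 1))).supNorm) (n₀ + 2 * K + 2 * k + 2) ≤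
      (fun m : ℕ ↦ ((((Literature.NumberTheory.EllipticCurves.mazurTateElementK g Ω 2 m).map ι * ∏ v ∈ S₀, (1 - Polynomial.C (Literature.NumberTheory.EllipticCurves.embCoeff g ι (Rat.HeightOneSpectrum.natGenerator v)) * Polynomial.X + (if Rat.HeightOneSpectrum.natGenerator v ∣ M then 0 else Polynomial.C (Rat.HeightOneSpectrum.natGenerator v : PadicAlgCl 2)) * Polynomial.X ^ 2).comp (Polynomial.C ((Rat.HeightOneSpectrum.natGenerator v : PadicAlgCl 2)⁻¹) * (Polynomial.X + 1) ^ (PadicInt.toZModPow m (-(Literature.NumberTheory.EllipticCurves.GreenbergVatsal2000.frobeniusExponent 2 (Rat.HeightOneSpectrum.natGenerator v : ℤ_[2])))).val)) %ₘ ((Polynomial.X + 1) ^ 2 ^ m - 1))).supNorm) (n₀ + 2 * K + 2 * k)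
    rw [e1, e2]
    exact (h1.trans h2.symm).le
  exact ⟨K, h0, fun k ↦ gSide_growth_mul_of_stabilized ι Ω S₀ hg h2M ha2 hΩ h0 hst' k⟩

end GSide

end Summit.BirchSwinnertonDyer.BirchSwinnertonDyer.Theorems.ThetaLayerLambdaCongruenceAtTwo

end
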